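import Literature.Computability.Complexity.FourierDegree
import Literature.Computability.QuantumComplexity.InfluenceBounds
import HarnessLib

/-!
# Crux `PseudoBoundedAA` (stmt-QuantumAdvantage-15237, route SosSandwich) — OSSS for the tree's Boolean decision
# trees: `Var[p] ≤ D(f) · maxⱼ Infⱼ[p] / 4` for a polynomial `p` with the cube values of a total Boolean `f`

Support file 1/2 for the BOOLEAN CORNER of the rank-2 crux PB-AA (`Theses/SosSandwich.lean`, item
stmt-QuantumAdvantage-15237; route file, "NOT DECOMPOSED YET": *the Boolean corner `f = f² ∈ K_deg` (known with
exponents `Var/deg³` by OSSS + Midrijanis)*). The sibling file `SosSandwichPseudoBoundedAABooleanCorner.lean` combines the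
theorem below with the tree's `D(f) ≤ bs(f)·deg(f)` (Midrijanis) and `bs ≤ 4 deg²` (Beals et al. core) to prove the body
of PB-AA with `(c, C) = (3, 1/8)` for every pseudo-bounded `p` that is `{0,1}`-valued on the cube.

This file: the O'Donnell–Saks–Schramm–Servedio inequality in DEPTH form for the tree's own Boolean decision trees
`Literature.Computability.Complexity.DecisionTree` (arbitrary trees — repeated queries allowed — and the tree's
`detQueryComplexity`), in the vocabulary of the crux (`evalBool`, `boolVariance`, `influence` of
`AaronsonAmbainis.lean`, which are the route items' inline `ev` / `avg` by `rfl`):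

* `osss_depth_aux`, `osss_depth` — two-function form `2^N Σ F g − (Σ F)(Σ g) ≤ depth(T) · 2^N · M / 4` for the `0/1`
  output `F` of `T` and any real `g` whose `L¹` increments `Σ_x |g(x^{j→1}) − g(x^{j→0})|` are `≤ M`; proved by
  INDUCTION ON THE TREE relative to a partial assignment of already-queried variables (H. K. Lee's inductive route:
  at a fresh root variable `i`, `Cov[F,g] = ½Cov[F₀,Γ] + ½Cov[F₁,Γ] + ¼E[(F₁−F₀)(g₁−g₀)]` with `Γ` the average of
  the two `i`-sections of `g`, whose increments are dominated by those of `g` — `sum_abs_sections_le`);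
* `exists_influence_ge_of_decisionTree` — for a real polynomial `p` taking on the cube the `0/1` values of a total
  Boolean `f` with `Var[p] > 0`: some `j` has `Var[p] ≤ D(f) · Inf_j[p] / 4` (the one-function OSSS inequality
  `Var ≤ Σ_j δ_j Inf_j ≤ D · maxInf`, `{0,1}`-normalised).

Relation to the tree: `Literature/Probability/ODonnellSaksSchrammServedio2005/DecisionTreeCovariance.lean` proves the
two-function OSSS inequality for its own real-leaf REDUCED trees `DTree` by the hybrid argument; the present file is
the bridge-free version for `DecisionTree`/`detQueryComplexity` (pruning of repeated queries is built into the
induction through the partial assignment), which is what the Boolean corner consumes. All proved, no named fact.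

Sources: R. O'Donnell, M. Saks, O. Schramm, R. Servedio, *Every decision tree has an influential variable*, FOCS 2005
(arXiv:cs/0508071), Thm 1.1 / Thm 3.2; H. K. Lee, *Decision trees and influence: an inductive proof of the OSSS
inequality*, Theory of Computing 6 (2010) 81–84, Thm 1; R. O'Donnell, *Analysis of Boolean Functions* (CUP 2014) §8.6.
-/

set_option linter.dupNamespace false

noncomputable section

namespace Summit.QuantumAdvantage.QuantumAdvantage.Theorems.SosSandwich

open Finset Function
open Literature.Computability.Complexity Literature.Computability.QuantumComplexity

namespace BooleanCorner

variable {N : ℕ}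

/-! ### Cube sums branching on one coordinate -/

/-- A cube sum of a branch on `x i` between two functions not depending on `x i` is the average of their sums.
[folklore] -/
theorem sum_ite_update (i : Fin N) (ψ₁ ψ₀ : (Fin N → Bool) → ℝ)
    (h₁ : ∀ x c, ψ₁ (update x i c) = ψ₁ x) (h₀ : ∀ x c, ψ₀ (update x i c) = ψ₀ x) :
    ∑ x, (if x i = true then ψ₁ x else ψ₀ x) = ((∑ x, ψ₁ x) + ∑ x, ψ₀ x) / 2 := by
  let τ : (Fin N → Bool) → (Fin N → Bool) := fun x => update x i (!x i)
  have hτ : Function.Involutive τ := by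
    intro x
    simp only [τ, update_self, update_idem, Bool.not_not, update_eq_self]
  have key : ∑ x, (if x i = true then ψ₁ x else ψ₀ x) = ∑ x, (if x i = true then ψ₀ x else ψ₁ x) := by
    rw [← Equiv.sum_comp (hτ.toPerm τ) (fun x => if x i = true then ψ₀ x else ψ₁ x)]
    refine Finset.sum_congr rfl fun x _ => ?_
    simp only [Function.Involutive.coe_toPerm]
    rcases Bool.eq_false_or_eq_true (x i) with hx | hx
    · simp [τ, hx, h₁]
    · simp [τ, hx, h₀]
  have hsum : (∑ x, (if x i = true then ψ₁ x else ψ₀ x)) + ∑ x, (if x i = true then ψ₀ x else ψ₁ x)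
      = (∑ x, ψ₁ x) + ∑ x, ψ₀ x := by
    rw [← Finset.sum_add_distrib, ← Finset.sum_add_distrib]
    exact Finset.sum_congr rfl fun x _ => by split_ifs <;> ring
  rw [← key] at hsum
  linarith

/-- `Σ_x h(x) = (Σ_x h(x^{i→1}) + Σ_x h(x^{i→0})) / 2`. [folklore] -/
theorem sum_eq_half_sum_update (i : Fin N) (h : (Fin N → Bool) → ℝ) :
    ∑ x, h x = ((∑ x, h (update x i true)) + ∑ x, h (update x i false)) / 2 := by
  have hre : ∑ x, h x = ∑ x, (if x i = true then h (update x i true) else h (update x i false)) := by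
    refine Finset.sum_congr rfl fun x _ => ?_
    split_ifs with hx
    · rw [← hx, update_eq_self]
    · rw [Bool.not_eq_true] at hx
      rw [← hx, update_eq_self]
  rw [hre]
  exact sum_ite_update i _ _ (fun x c => by simp) (fun x c => by simp)

/-- The `L¹` increments of an average `(g₀ + g₁)/2` of the two `i`-sections of `g` are dominated by those of `g`:
for `j ≠ i`, `Σ_x |Γ(x^{j→1}) − Γ(x^{j→0})| ≤ Σ_x |g(x^{j→1}) − g(x^{j→0})|` with
`Γ(x) = (g(x^{i→0}) + g(x^{i→1}))/2`; for `j = i` the left side vanishes. [folklore] -/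
theorem sum_abs_sections_le (i j : Fin N) (g : (Fin N → Bool) → ℝ) :
    ∑ x, |(g (update (update x j true) i false) + g (update (update x j true) i true)) / 2
        - (g (update (update x j false) i false) + g (update (update x j false) i true)) / 2|
      ≤ ∑ x, |g (update x j true) - g (update x j false)| := by
  by_cases hji : j = i
  · subst hji
    have h0 : ∀ x : Fin N → Bool,
        |(g (update (update x j true) j false) + g (update (update x j true) j true)) / 2
          - (g (update (update x j false) j false) + g (update (update x j false) j true)) / 2| = 0 := by
      intro x; simp
    rw [Finset.sum_congr rfl fun x _ => h0 x, Finset.sum_const_zero]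
    exact Finset.sum_nonneg fun x _ => abs_nonneg _
  -- `j ≠ i`: commute the updates and average the two `i`-sections
  have hcomm : ∀ (x : Fin N → Bool) (c b : Bool), update (update x j c) i b = update (update x i b) j c :=
    fun x c b => update_comm hji _ _ _
  set h : (Fin N → Bool) → ℝ := fun y => |g (update y j true) - g (update y j false)| with hh
  have hsplit := sum_eq_half_sum_update i h
  have htri : ∀ x : Fin N → Bool,
      |(g (update (update x j true) i false) + g (update (update x j true) i true)) / 2
        - (g (update (update x j false) i false) + g (update (update x j false) i true)) / 2|
        ≤ (h (update x i true) + h (update x i false)) / 2 := by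
    intro x
    simp only [hh, hcomm]
    have := abs_add_le (( g (update (update x i true) j true) - g (update (update x i true) j false)) / 2)
      ((g (update (update x i false) j true) - g (update (update x i false) j false)) / 2)
    rw [abs_div, abs_div, abs_two] at this
    calc _ = |(g (update (update x i true) j true) - g (update (update x i true) j false)) / 2
          + (g (update (update x i false) j true) - g (update (update x i false) j false)) / 2| := by
            congr 1; ring
      _ ≤ _ := this
      _ = _ := by ring
  calc _ ≤ ∑ x, (h (update x i true) + h (update x i false)) / 2 := Finset.sum_le_sum fun x _ => htri x
    _ = ((∑ x, h (update x i true)) + ∑ x, h (update x i false)) / 2 := by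
        rw [← Finset.sum_div, Finset.sum_add_distrib]
    _ = ∑ x, h x := hsplit.symm
    _ = _ := by simp only [hh]

/-! ### The OSSS inequality in depth form, by induction on the tree relative to a partial assignment -/

/-- The cube `{0,1}^N` has `2^N` points. [folklore] -/
theorem card_cube_nat : Fintype.card (Fin N → Bool) = 2 ^ N := by
  rw [Fintype.card_fun, Fintype.card_bool, Fintype.card_fin]

/-- **OSSS, two-function depth form, inductive version.** For a Boolean decision tree `T` run on the input
overridden by a partial assignment `ρ` (`x ↦ (k ↦ (ρ k).getD (x k))`; repeated queries are answered consistently),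
with `0/1` output `F`, and any `g` on the cube whose `L¹` increments `Σ_x |g(x^{j→1}) − g(x^{j→0})|` are all `≤ M`:
`2^N Σ F·g − (Σ F)(Σ g) ≤ depth(T) · 2^N · M / 4`, i.e. `Cov[F, g] ≤ depth(T) · maxⱼ E|g(x^{j→1}) − g(x^{j→0})| / 4`.
Induction on `T` (Lee's inductive route to OSSS): at a fresh root variable `i`,
`Cov[F,g] = ½Cov[F₀,Γ] + ½Cov[F₁,Γ] + E[(F₁−F₀)(g₁−g₀)]/4` with `F_b, g_b` the `i`-sections and `Γ = (g₀+g₁)/2`,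
whose increments are dominated by those of `g` (`sum_abs_sections_le`), and `|F₁ − F₀| ≤ 1`.
[cite: OdonnellEtAl2005, Thm 3.2] [cite: Lee2010, Thm 1 (inductive proof)] -/
theorem osss_depth_aux (T : DecisionTree N) :
    ∀ (ρ : Fin N → Option Bool) (F g : (Fin N → Bool) → ℝ) (M : ℝ),
      (∀ x, F x = if T.eval (fun k => (ρ k).getD (x k)) = true then (1 : ℝ) else 0) → 0 ≤ M →
      (∀ j : Fin N, ∑ x, |g (update x j true) - g (update x j false)| ≤ M) →
      (2 : ℝ) ^ N * (∑ x, F x * g x) - (∑ x, F x) * (∑ x, g x) ≤ (T.depth : ℝ) * (2 : ℝ) ^ N * M / 4 := by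
  induction T with
  | leaf c =>
    intro ρ F g M hF hM hg
    have hc : ∀ x : Fin N → Bool, F x = (if c = true then (1 : ℝ) else 0) := fun x => by
      rw [hF x]; simp [DecisionTree.eval]
    have h1 : ∑ x, F x * g x = (if c = true then (1 : ℝ) else 0) * ∑ x, g x := by
      rw [Finset.mul_sum]; exact Finset.sum_congr rfl fun x _ => by rw [hc x]
    have h2 : ∑ x, F x = (2 : ℝ) ^ N * (if c = true then (1 : ℝ) else 0) := by
      rw [Finset.sum_congr rfl fun x _ => hc x, Finset.sum_const, Finset.card_univ, card_cube_nat, nsmul_eq_mul]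
      push_cast; ring
    rw [h1, h2, DecisionTree.depth_leaf]
    simp
  | query i t₀ t₁ ih₀ ih₁ =>
    intro ρ F g M hF hM hg
    have hpos : (0 : ℝ) ≤ (2 : ℝ) ^ N * M / 4 := by positivity
    rcases hρ : ρ i with _ | b
    · /- fresh query: split along `x i` -/
      set F₀ : (Fin N → Bool) → ℝ :=
        fun x => if t₀.eval (fun k => ((update ρ i (some false)) k).getD (x k)) = true then (1 : ℝ) else 0 with hF₀
      set F₁ : (Fin N → Bool) → ℝ :=
        fun x => if t₁.eval (fun k => ((update ρ i (some true)) k).getD (x k)) = true then (1 : ℝ) else 0 with hF₁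
      set g₀ : (Fin N → Bool) → ℝ := fun x => g (update x i false) with hg₀
      set g₁ : (Fin N → Bool) → ℝ := fun x => g (update x i true) with hg₁
      set Γ : (Fin N → Bool) → ℝ := fun x => (g₀ x + g₁ x) / 2 with hΓ
      -- overriding by `ρ[i ↦ b]` ignores `x i`
      have hov : ∀ (b c : Bool) (x : Fin N → Bool),
          (fun k => ((update ρ i (some b)) k).getD ((update x i c) k))
            = fun k => ((update ρ i (some b)) k).getD (x k) := by
        intro b c x; funext k
        by_cases hk : k = i
        · subst hk; simp
        · simp [hk]
      have hF₀u : ∀ x c, F₀ (update x i c) = F₀ x := fun x c => by simp only [hF₀, hov]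
      have hF₁u : ∀ x c, F₁ (update x i c) = F₁ x := fun x c => by simp only [hF₁, hov]
      have hg₀u : ∀ x c, g₀ (update x i c) = g₀ x := fun x c => by simp [hg₀]
      have hg₁u : ∀ x c, g₁ (update x i c) = g₁ x := fun x c => by simp [hg₁]
      -- on the branch `x i = b` the override by `ρ` is the override by `ρ[i ↦ b]`
      have hovb : ∀ (x : Fin N → Bool),
          (fun k => (ρ k).getD (x k)) = fun k => ((update ρ i (some (x i))) k).getD (x k) := by
        intro x; funext k
        by_cases hk : k = i
        · subst hk; simp [hρ]
        · simp [hk]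
      have hxi : ∀ x : Fin N → Bool, (ρ i).getD (x i) = x i := fun x => by simp [hρ]
      have hFx : ∀ x : Fin N → Bool, F x = if x i = true then F₁ x else F₀ x := by
        intro x
        rw [hF x, DecisionTree.eval_query]
        simp only [hxi x]
        rcases Bool.eq_false_or_eq_true (x i) with hx | hx
        · rw [if_pos hx, if_pos hx, hF₁]
          simp only
          rw [hovb x, hx]
        · have hx' : ¬ (x i = true) := by rw [hx]; decide
          rw [if_neg hx', if_neg hx', hF₀]
          simp only
          rw [hovb x, hx]
      have hgs : ∀ x : Fin N → Bool, g x = if x i = true then g₁ x else g₀ x := by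
        intro x
        rcases Bool.eq_false_or_eq_true (x i) with hx | hx
        · rw [if_pos hx, hg₁]; simp only; rw [← hx, update_eq_self]
        · have hx' : ¬ (x i = true) := by rw [hx]; decide
          rw [if_neg hx', hg₀]; simp only; rw [← hx, update_eq_self]
      -- the six sums
      have hSfg : ∑ x, F x * g x = ((∑ x, F₁ x * g₁ x) + ∑ x, F₀ x * g₀ x) / 2 := by
        have : ∀ x, F x * g x = if x i = true then F₁ x * g₁ x else F₀ x * g₀ x := by
          intro x; rw [hFx x]
          rcases Bool.eq_false_or_eq_true (x i) with hx | hx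
          · rw [if_pos hx, if_pos hx, hgs x, if_pos hx]
          · have hx' : ¬ (x i = true) := by rw [hx]; decide
            rw [if_neg hx', if_neg hx', hgs x, if_neg hx']
        rw [Finset.sum_congr rfl fun x _ => this x]
        exact sum_ite_update i _ _ (fun x c => by rw [hF₁u, hg₁u]) (fun x c => by rw [hF₀u, hg₀u])
      have hSf : ∑ x, F x = ((∑ x, F₁ x) + ∑ x, F₀ x) / 2 := by
        rw [Finset.sum_congr rfl fun x _ => hFx x]
        exact sum_ite_update i _ _ hF₁u hF₀u
      have hSg : ∑ x, g x = ((∑ x, g₁ x) + ∑ x, g₀ x) / 2 := by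
        conv_lhs => rw [Finset.sum_congr rfl fun x (_ : x ∈ Finset.univ) => hgs x]
        exact sum_ite_update i _ _ hg₁u hg₀u
      -- induction hypotheses on the sections, against `Γ`
      have hΓ_incr : ∀ j : Fin N, ∑ x, |Γ (update x j true) - Γ (update x j false)| ≤ M := by
        intro j
        refine le_trans ?_ (hg j)
        simp only [hΓ, hg₀, hg₁]
        exact sum_abs_sections_le i j g
      have IH₀ := ih₀ (update ρ i (some false)) F₀ Γ M (fun x => rfl) hM hΓ_incr
      have IH₁ := ih₁ (update ρ i (some true)) F₁ Γ M (fun x => rfl) hM hΓ_incr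
      have hΓ₀ : ∑ x, F₀ x * Γ x = ((∑ x, F₀ x * g₀ x) + ∑ x, F₀ x * g₁ x) / 2 := by
        rw [← Finset.sum_add_distrib, Finset.sum_div]
        exact Finset.sum_congr rfl fun x _ => by simp only [hΓ]; ring
      have hΓ₁ : ∑ x, F₁ x * Γ x = ((∑ x, F₁ x * g₀ x) + ∑ x, F₁ x * g₁ x) / 2 := by
        rw [← Finset.sum_add_distrib, Finset.sum_div]
        exact Finset.sum_congr rfl fun x _ => by simp only [hΓ]; ring
      have hΓs : ∑ x, Γ x = ((∑ x, g₀ x) + ∑ x, g₁ x) / 2 := by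
        rw [← Finset.sum_add_distrib, Finset.sum_div]
      rw [hΓ₀, hΓs] at IH₀
      rw [hΓ₁, hΓs] at IH₁
      -- the cross term `Σ (F₁ − F₀)(g₁ − g₀) ≤ Σ |g₁ − g₀| ≤ M`
      have hF01 : ∀ x, |F₁ x - F₀ x| ≤ 1 := by
        intro x; simp only [hF₁, hF₀]; split_ifs <;> norm_num
      have hcross : (∑ x, F₁ x * g₁ x) - (∑ x, F₁ x * g₀ x) - (∑ x, F₀ x * g₁ x) + ∑ x, F₀ x * g₀ x ≤ M := by
        have h1 : (∑ x, F₁ x * g₁ x) - (∑ x, F₁ x * g₀ x) - (∑ x, F₀ x * g₁ x) + ∑ x, F₀ x * g₀ x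
            = ∑ x, (F₁ x - F₀ x) * (g₁ x - g₀ x) := by
          rw [← Finset.sum_sub_distrib, ← Finset.sum_sub_distrib, ← Finset.sum_add_distrib]
          exact Finset.sum_congr rfl fun x _ => by ring
        rw [h1]
        calc ∑ x, (F₁ x - F₀ x) * (g₁ x - g₀ x) ≤ ∑ x, |g₁ x - g₀ x| := by
              refine Finset.sum_le_sum fun x _ => ?_
              calc (F₁ x - F₀ x) * (g₁ x - g₀ x) ≤ |(F₁ x - F₀ x) * (g₁ x - g₀ x)| := le_abs_self _
                _ = |F₁ x - F₀ x| * |g₁ x - g₀ x| := abs_mul _ _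
                _ ≤ 1 * |g₁ x - g₀ x| := mul_le_mul_of_nonneg_right (hF01 x) (abs_nonneg _)
                _ = |g₁ x - g₀ x| := one_mul _
          _ ≤ M := by simpa only [hg₁, hg₀] using hg i
      -- depths
      have hd : ((DecisionTree.query i t₀ t₁).depth : ℝ) = max (t₀.depth : ℝ) (t₁.depth : ℝ) + 1 := by
        rw [DecisionTree.depth_query]; push_cast; rfl
      have hd₀ : (t₀.depth : ℝ) ≤ max (t₀.depth : ℝ) (t₁.depth : ℝ) := le_max_left _ _
      have hd₁ : (t₁.depth : ℝ) ≤ max (t₀.depth : ℝ) (t₁.depth : ℝ) := le_max_right _ _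
      rw [hSfg, hSf, hSg, hd]
      have h2N : (0 : ℝ) ≤ (2 : ℝ) ^ N := by positivity
      nlinarith [IH₀, IH₁, hcross, mul_le_mul_of_nonneg_right hd₀ hpos, mul_le_mul_of_nonneg_right hd₁ hpos,
        mul_nonneg h2N hM]
    · /- the root variable is already assigned by `ρ`: the tree behaves as the `b`-subtree -/
      have hxi : ∀ x : Fin N → Bool, (ρ i).getD (x i) = b := fun x => by simp [hρ]
      have hdq : ∀ t : DecisionTree N, t.depth ≤ (DecisionTree.query i t₀ t₁).depth →
          (t.depth : ℝ) * (2 : ℝ) ^ N * M / 4 ≤ ((DecisionTree.query i t₀ t₁).depth : ℝ) * (2 : ℝ) ^ N * M / 4 := by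
        intro t ht
        have ht' : (t.depth : ℝ) ≤ ((DecisionTree.query i t₀ t₁).depth : ℝ) := by exact_mod_cast ht
        have := mul_le_mul_of_nonneg_right ht' hpos
        linarith
      cases b with
      | false =>
        have hF' : ∀ x, F x = if t₀.eval (fun k => (ρ k).getD (x k)) = true then (1 : ℝ) else 0 := by
          intro x; rw [hF x, DecisionTree.eval_query]; simp only [hxi x]; rfl
        exact (ih₀ ρ F g M hF' hM hg).trans
          (hdq t₀ (by rw [DecisionTree.depth_query]; exact (le_max_left _ _).trans (Nat.le_succ _)))
      | true =>
        have hF' : ∀ x, F x = if t₁.eval (fun k => (ρ k).getD (x k)) = true then (1 : ℝ) else 0 := by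
          intro x; rw [hF x, DecisionTree.eval_query]; simp only [hxi x]; rfl
        exact (ih₁ ρ F g M hF' hM hg).trans
          (hdq t₁ (by rw [DecisionTree.depth_query]; exact (le_max_right _ _).trans (Nat.le_succ _)))

/-- **OSSS, two-function depth form** for the tree's Boolean decision trees (no partial assignment): with `F` the `0/1`
output of `T` and every `L¹` increment of `g` at most `M`, `2^N Σ F·g − (Σ F)(Σ g) ≤ depth(T) · 2^N · M / 4`.
[cite: OdonnellEtAl2005, Thm 3.2] [cite: Lee2010, Thm 1] -/
theorem osss_depth (T : DecisionTree N) (F g : (Fin N → Bool) → ℝ) (M : ℝ)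
    (hF : ∀ x, F x = if T.eval x = true then (1 : ℝ) else 0) (hM : 0 ≤ M)
    (hg : ∀ j : Fin N, ∑ x, |g (update x j true) - g (update x j false)| ≤ M) :
    (2 : ℝ) ^ N * (∑ x, F x * g x) - (∑ x, F x) * (∑ x, g x) ≤ (T.depth : ℝ) * (2 : ℝ) ^ N * M / 4 :=
  osss_depth_aux T (fun _ => none) F g M (fun x => by rw [hF x]; rfl) hM hg

/-! ### From the depth form to influences and variance of a `{0,1}`-valued polynomial -/

/-- For a polynomial `p` that is `{0,1}`-valued on the cube, the `L¹` increment in direction `j` is `2^N · Inf_j[p]`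
(`|p(x^{j→1}) − p(x^{j→0})| = (p(x) − p(xʲ))²` pointwise). [folklore] -/
theorem sum_abs_update_eq_influence (p : MvPolynomial (Fin N) ℝ) (h01 : ∀ x, evalBool p x = 0 ∨ evalBool p x = 1)
    (j : Fin N) :
    ∑ x, |evalBool p (update x j true) - evalBool p (update x j false)| = (2 : ℝ) ^ N * influence j p := by
  unfold influence boolAvg
  rw [mul_div_cancel₀ _ (by positivity : (2 : ℝ) ^ N ≠ 0)]
  refine Finset.sum_congr rfl fun x _ => ?_
  have hsq : ∀ a b : ℝ, (a = 0 ∨ a = 1) → (b = 0 ∨ b = 1) → |a - b| = (a - b) ^ 2 := by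
    intro a b ha hb
    rcases ha with rfl | rfl <;> rcases hb with rfl | rfl <;> norm_num
  dsimp only [flipBit]
  rcases Bool.eq_false_or_eq_true (x j) with hx | hx
  · have hu : update x j true = x := by rw [← hx]; exact update_eq_self j x
    rw [hu, hx, Bool.not_true, hsq _ _ (h01 _) (h01 _)]
  · have hu : update x j false = x := by rw [← hx]; exact update_eq_self j x
    rw [hu, hx, Bool.not_false, hsq _ _ (h01 _) (h01 _), ← neg_sub, neg_sq]

/-- `Σ_x (F x − c)² = Σ F² − 2c Σ F + 2^N c²` on the cube. [folklore] -/
theorem sum_sub_const_sq (F : (Fin N → Bool) → ℝ) (c : ℝ) :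
    ∑ x, (F x - c) ^ 2 = (∑ x, F x ^ 2) - 2 * c * (∑ x, F x) + (2 : ℝ) ^ N * c ^ 2 := by
  have h : ∀ x : Fin N → Bool, (F x - c) ^ 2 = F x ^ 2 - 2 * c * F x + c ^ 2 := fun x => by ring
  rw [Finset.sum_congr rfl fun x _ => h x, Finset.sum_add_distrib, Finset.sum_sub_distrib, Finset.sum_const,
    Finset.card_univ, card_cube_nat, ← Finset.mul_sum, nsmul_eq_mul]
  push_cast; ring

/-- The sum-form variance is `2^{2N}` times the tree's `boolVariance`: `2^N Σ F² − (Σ F)² = 2^N · 2^N · Var[p]`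
for `F = evalBool p`. [folklore] -/
theorem sum_sq_sub_sq_sum_eq (p : MvPolynomial (Fin N) ℝ) :
    (2 : ℝ) ^ N * (∑ x, evalBool p x * evalBool p x) - (∑ x, evalBool p x) * (∑ x, evalBool p x)
      = (2 : ℝ) ^ N * ((2 : ℝ) ^ N * boolVariance p) := by
  have h2 : (2 : ℝ) ^ N ≠ 0 := by positivity
  have hv : (2 : ℝ) ^ N * boolVariance p = ∑ x, (evalBool p x - (∑ y, evalBool p y) / (2 : ℝ) ^ N) ^ 2 := by
    unfold boolVariance boolAvg
    rw [mul_div_cancel₀ _ h2]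
  rw [hv, sum_sub_const_sq]
  have hsq : ∑ x, evalBool p x * evalBool p x = ∑ x, evalBool p x ^ 2 :=
    Finset.sum_congr rfl fun x _ => by ring
  rw [hsq]
  field_simp
  ring

/-- On zero variables the cube is a point, so every variance vanishes. [folklore] -/
theorem boolVariance_fin_zero (p : MvPolynomial (Fin 0) ℝ) : boolVariance p = 0 := by
  unfold boolVariance boolAvg
  simp

/-- **OSSS for total Boolean functions, polynomial form.** If the real polynomial `p` takes on the cube the `0/1`
values of the total Boolean function `f`, then for the variable `j` of largest influence
`Var[p] ≤ D(f) · Inf_j[p] / 4` — O'Donnell–Saks–Schramm–Servedio's "every decision tree has an influential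
variable", `maxⱼ Infⱼ ≥ 4·Var/D(f)` in the `{0,1}`-normalisation of the tree's `boolVariance`/`influence`.
[cite: OdonnellEtAl2005, Thm 1.1] [cite: ODonnell2014, §8.6] -/
theorem exists_influence_ge_of_decisionTree (p : MvPolynomial (Fin N) ℝ) (f : (Fin N → Bool) → Bool)
    (hpf : ∀ x, evalBool p x = realOf f x) (hv : 0 < boolVariance p) :
    ∃ j : Fin N, boolVariance p ≤ (detQueryComplexity f : ℝ) * influence j p / 4 := by
  classical
  rcases Nat.eq_zero_or_pos N with hN0 | hNpos
  · subst hN0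
    exact absurd (boolVariance_fin_zero p) (ne_of_gt hv)
  have hne : (Finset.univ : Finset (Fin N)).Nonempty := ⟨⟨0, hNpos⟩, Finset.mem_univ _⟩
  obtain ⟨j, -, hj⟩ := Finset.exists_max_image Finset.univ (fun j => influence j p) hne
  refine ⟨j, ?_⟩
  obtain ⟨T, hdepth, hcomp⟩ := exists_depth_eq_detQueryComplexity f
  have h01 : ∀ x, evalBool p x = 0 ∨ evalBool p x = 1 := by
    intro x; rw [hpf x, realOf_apply]; cases f x <;> simp
  have hF : ∀ x, evalBool p x = if T.eval x = true then (1 : ℝ) else 0 := by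
    intro x; rw [hpf x, realOf_apply, hcomp x]
  have hIj := influence_nonneg j p
  have h2N : (0 : ℝ) < (2 : ℝ) ^ N := by positivity
  have hM : ∀ j' : Fin N, ∑ x, |evalBool p (update x j' true) - evalBool p (update x j' false)|
      ≤ (2 : ℝ) ^ N * influence j p := by
    intro j'
    rw [sum_abs_update_eq_influence p h01 j']
    exact mul_le_mul_of_nonneg_left (hj j' (Finset.mem_univ _)) h2N.le
  have key := osss_depth T (evalBool p) (evalBool p) ((2 : ℝ) ^ N * influence j p) hF (by positivity) hM
  rw [sum_sq_sub_sq_sum_eq, hdepth] at key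
  -- `2^N · (2^N Var) ≤ D · 2^N · (2^N Inf_j) / 4`
  have key' : (2 : ℝ) ^ N * ((2 : ℝ) ^ N * boolVariance p)
      ≤ (2 : ℝ) ^ N * ((2 : ℝ) ^ N * ((detQueryComplexity f : ℝ) * influence j p / 4)) := by
    calc _ ≤ (detQueryComplexity f : ℝ) * (2 : ℝ) ^ N * ((2 : ℝ) ^ N * influence j p) / 4 := key
      _ = _ := by ring
  exact le_of_mul_le_mul_left (le_of_mul_le_mul_left key' h2N) h2N

end BooleanCorner

end Summit.QuantumAdvantage.QuantumAdvantage.Theorems.SosSandwich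

end
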